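import Summits.HodgeConjecture.HodgeConjecture.Theorems.HeckePrymWeilWeilTwelvefoldsSqrtMinus7IsotypicDescent
import Summits.HodgeConjecture.HodgeConjecture.Theorems.HeckePrymWeilHeckePrymAnchorsSurfaceProductStep
import Literature.AlgebraicGeometry.HodgeTheory.WeilClassesProducts
import HarnessLib

/-!
# Route `HeckePrymWeil`, CM-anchor ladder · the rational Weil WITNESS of a product (every `d`, every dimension)

Crux `WeilTwelvefoldsSqrtMinus7` (stmt-HodgeConjecture-1261), line `isotypic-unimodular-saturation`,
skeleton r2 (lead seat c3) replaces the Hecke–Prym anchor by a CM anchor `Z = B^k` (`B` a CM Weil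
surface).  To AIM `Z × B` onto the hyperbolic component (Markman §11.5 Step 2, the tree's
`Motives.aimedSplitProduct_cmSquare_of_pos` / `exists_weilTypeSurface_prod_isHyperbolicWeilType_all_holds`)
one needs a NON-ZERO RATIONAL `(k,k)`-class in the Weil plane of `Z`; this file produces it for
products, in every dimension and for every `d ≥ 1`, in the tree's strong typing `weilClassesOf`:

* `weilWitness_prod` — for complex abelian varieties `(A₁, φ₁)` of dimension `2n₁` and `(A₂, φ₂)` of
  dimension `2n₂` (`n₁, n₂, d ≥ 1`, `2n₁ + 2n₂ = 2n`), a non-zero rational `(n₁,n₁)` class of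
  `weilClassesOf A₁ φ₁ n₁ d` and a rational `(n₂,n₂)` class `u₂ + v₂` of `A₂` with BOTH Weil
  components `u₂ ∈ E₊`, `v₂ ∈ E₋` non-zero give a non-zero rational `(n,n)` class of
  `weilClassesOf (A₁ × A₂) (φ₁ × φ₂) n d`.

Proof = the rational Weil projector of Schoen 1998 §10 EXACTLY as in the tree's
`weilEigencomponents_cupProduct_mem_algebraicClasses` (`HodgeTheory/WeilClassesProducts`, all
dimensions, all `d`): `P = pr₁^*(u₁+v₁) ∪ pr₂^*(u₂+v₂) = P₊₊ + P₋₋ + P₊₋ + P₋₊`, `T = (x·𝟙 + φ₁×φ₂)^*`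
for an `x` separating the characters (`exists_nat_pow_ne_and`), `Q = T²P - (β+β')TP + ββ'P =
q(α)P₊₊ + q(ᾱ)P₋₋` (`weilProjector_eq`) with `q(α), q(ᾱ) ≠ 0`; `Q` is rational (`β + β' ∈ ℤ`,
`ββ' ∈ ℤ`), of Hodge type `(n,n)` (Künneth for Hodge types — the sibling line's PROVED
`AmnesicSecantSheaves.stub_hodgeTypeExterior` fed with de Rham's theorem
`exists_deRhamIsoFamily_holds` — and `HodgeModel.pullback_map_mem_hodgePQ_of_endomorphism`), a Weil
class, and NON-ZERO: one of `u₁`, `v₁` is non-zero, so `P₊₊` or `P₋₋` is non-zero by Künneth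
non-vanishing (`HeckePrymWeilLine.sps_cupProduct_map_fst_map_snd_ne_zero_prod`), and `Q = 0` would
force `P₊₊ = P₋₋ = 0` (`mem_and_mem_of_smul_add_smul_mem` for the subspace `⊥`).  No named fact, no
`sorry`, no new definition.
-/

noncomputable section

-- every declaration of this problem lives in Summit.HodgeConjecture.HodgeConjecture.… (summit = sub-problem)
set_option linter.dupNamespace false

open CategoryTheory
open Literature.AlgebraicGeometry Literature.AlgebraicGeometry.Motives
  Literature.AlgebraicGeometry.HodgeTheory Literature.AlgebraicTopology.SingularHomology

namespace Summit.HodgeConjecture.HodgeConjecture.Theorems.HeckePrymWeilLine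

open Summit.HodgeConjecture.HodgeConjecture.Theorems.WeilTwelvefoldsSqrtMinus7 (AmnesicSecantSheaves.stub_hodgeTypeExterior)

/-- **Künneth for Hodge types on `A₁ × A₂`, unconditionally** (the sibling line's
`AmnesicSecantSheaves.stub_hodgeTypeExterior` with its de Rham antecedent discharged by
`exists_deRhamIsoFamily_holds`): `pr₁^*c ∪ pr₂^*w` is of type `(p + p', q + q')` for `c` of type
`(p,q)` and `w` of type `(p',q')`. [cite: VoisinHodgeI2002, §7.3.2 and §11.3.2] -/
theorem isOfHodgeType_cupProduct_fst_snd (A B : AbelianVariety ℂ) (a b : ℕ) (hA : A.dim = a)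
    (hB : B.dim = b) (k l m : ℕ) (hklm : k + l = m) (p q p' q' : ℕ) (c : complexBetti A.X k)
    (w : complexBetti B.X l) (hc : IsOfHodgeType a A.X k p q c) (hw : IsOfHodgeType b B.X l p' q' w) :
    IsOfHodgeType (a + b) (A.prod B).X m (p + p') (q + q')
      (cupProduct hklm (complexBetti.map (AbelianVariety.fst A B).hom.hom.hom k c)
        (complexBetti.map (AbelianVariety.snd A B).hom.hom.hom l w)) :=
  AmnesicSecantSheaves.stub_hodgeTypeExterior
    (fun E _ _ _ => Literature.NumberTheory.Transcendental.exists_deRhamIsoFamily_holds E)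
    A B a b hA hB k l m hklm p q p' q' c w hc hw

/-- **The rational Weil WITNESS of a product (Schoen's rational Weil projector, every dimension, every
`d ≥ 1`).**  Let `(A₁, φ₁)`, `(A₂, φ₂)` be complex abelian varieties of dimensions `2n₁`, `2n₂`
(`n₁, n₂ ≥ 1`, `2n₁ + 2n₂ = 2n`).  From a NON-ZERO rational `(n₁,n₁)`-class of the Weil plane
`weilClassesOf A₁ φ₁ n₁ d` and a rational `(n₂,n₂)`-class `u₂ + v₂` of `A₂` with non-zero Weil
components `u₂ ∈ E₊(A₂)`, `v₂ ∈ E₋(A₂)`, one gets a NON-ZERO rational `(n,n)`-class of the Weil plane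
`weilClassesOf (A₁ × A₂) (φ₁ × φ₂) n d`: the projected class `Q = q(T)P`,
`P = pr₁^*(u₁+v₁) ∪ pr₂^*(u₂+v₂)`, `T = (x·𝟙 + φ₁×φ₂)^*`, `q(X) = (X-β)(X-β̄)` killing the mixed
pieces — rational since `β + β̄, ββ̄ ∈ ℤ`, of type `(n,n)` by Künneth for Hodge types, and non-zero
because `q(α)·P₊₊ ≠ 0` or `q(ᾱ)·P₋₋ ≠ 0` (Künneth non-vanishing) sit in different eigenspaces of `T`.
[cite: Schoen1998HodgeWeilAddendum, §10 (proof of the Proposition, pp. 332–333)]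
[cite: Markman2025SurveySecant, §11.5 Step 2] -/
theorem weilWitness_prod {A₁ A₂ : AbelianVariety ℂ} {φ₁ : A₁ ⟶ A₁} {φ₂ : A₂ ⟶ A₂}
    {n₁ n₂ n d : ℕ} (hn₁ : 0 < n₁) (hn₂ : 0 < n₂) (hd : 0 < d) (h : 2 * n₁ + 2 * n₂ = 2 * n)
    (hA₁ : A₁.dim = 2 * n₁) (hA₂ : A₂.dim = 2 * n₂)
    {u₂ v₂ : complexBetti A₂.X (2 * n₂)}
    (hu₂ : u₂ ∈ weilClassesPlus A₂ φ₂ n₂ d) (hv₂ : v₂ ∈ weilClassesMinus A₂ φ₂ n₂ d)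
    (hr₂ : IsRationalClass (u₂ + v₂)) (hH₂ : IsOfHodgeType (2 * n₂) A₂.X (2 * n₂) n₂ n₂ (u₂ + v₂))
    (hu₂0 : u₂ ≠ 0) (hv₂0 : v₂ ≠ 0)
    (hw : ∃ c : complexBetti A₁.X (2 * n₁), IsRationalClass c ∧
      IsOfHodgeType (2 * n₁) A₁.X (2 * n₁) n₁ n₁ c ∧ c ∈ weilClassesOf A₁ φ₁ n₁ d ∧ c ≠ 0) :
    ∃ c' : complexBetti (A₁.prod A₂).X (2 * n), IsRationalClass c' ∧
      IsOfHodgeType (2 * n) (A₁.prod A₂).X (2 * n) n n c' ∧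
      c' ∈ weilClassesOf (A₁.prod A₂)
        (AbelianVariety.prodLift (AbelianVariety.fst A₁ A₂ ≫ φ₁) (AbelianVariety.snd A₁ A₂ ≫ φ₂)) n d ∧
      c' ≠ 0 := by
  obtain ⟨c, hr₁, hH₁, hcW, hc0⟩ := hw
  -- `c = u₁ + v₁` along `E₊ ⊔ E₋`
  obtain ⟨u₁, hu₁, v₁, hv₁, rfl⟩ := Submodule.mem_sup.mp hcW
  have hA₁' : IsSmoothProjective (2 * n₁) A₁.X := sps_isSmoothProjective_of_dim_eq A₁ hA₁
  have hA₂' : IsSmoothProjective (2 * n₂) A₂.X := sps_isSmoothProjective_of_dim_eq A₂ hA₂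
  have hBX : IsSmoothProjective (2 * n) (A₁.prod A₂).X :=
    sps_isSmoothProjective_of_dim_eq (A₁.prod A₂) (by rw [AbelianVariety.dim_prod, hA₁, hA₂, h])
  set ψ := AbelianVariety.prodLift (AbelianVariety.fst A₁ A₂ ≫ φ₁) (AbelianVariety.snd A₁ A₂ ≫ φ₂)
    with hψdef
  have hp₁ : AbelianVariety.fst A₁ A₂ ≫ φ₁ = ψ ≫ AbelianVariety.fst A₁ A₂ := prod_fst_comm A₁ A₂ φ₁ φ₂
  have hp₂ : AbelianVariety.snd A₁ A₂ ≫ φ₂ = ψ ≫ AbelianVariety.snd A₁ A₂ := prod_snd_comm A₁ A₂ φ₁ φ₂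
  -- shorthands for the pull-backs
  set q₁ : complexBetti A₁.X (2 * n₁) → complexBetti (A₁.prod A₂).X (2 * n₁) := fun w ↦
    singularCohomology.map ℂ ℂ (Motives.AlgPoints.mapContinuous (L := ℂ)
      (AbelianVariety.fst A₁ A₂).hom.hom.hom) (2 * n₁) w with hq₁
  set q₂ : complexBetti A₂.X (2 * n₂) → complexBetti (A₁.prod A₂).X (2 * n₂) := fun w ↦
    singularCohomology.map ℂ ℂ (Motives.AlgPoints.mapContinuous (L := ℂ)
      (AbelianVariety.snd A₁ A₂).hom.hom.hom) (2 * n₂) w with hq₂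
  -- a test endomorphism `g = x·𝟙 + ψ` whose character values separate the four pieces
  have hsq : (Real.sqrt d : ℂ) ≠ 0 := by
    rw [Ne, Complex.ofReal_eq_zero]
    exact (Real.sqrt_pos.mpr (by exact_mod_cast hd)).ne'
  obtain ⟨x, hx₁₂, hx⟩ := exists_nat_pow_ne_and (mul_ne_zero Complex.I_ne_zero hsq)
    (m := 2 * n₁ * (2 * n₂)) (m' := 2 * n) (Nat.mul_pos (by omega) (by omega)) (by omega)
  set sp : ℂ := (x : ℂ) + Complex.I * (Real.sqrt d : ℂ) with hsp
  set sm : ℂ := (x : ℂ) - Complex.I * (Real.sqrt d : ℂ) with hsm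
  have hx₁ : sp ^ (2 * n₁) ≠ sm ^ (2 * n₁) := fun e ↦ hx₁₂ (by rw [pow_mul sp, pow_mul sm, e])
  have hx₂ : sp ^ (2 * n₂) ≠ sm ^ (2 * n₂) := fun e ↦
    hx₁₂ (by rw [mul_comm (2 * n₁) (2 * n₂), pow_mul sp, pow_mul sm, e])
  have hsp0 : sp ≠ 0 := natCast_add_I_mul_sqrt_ne_zero x hd
  have hsm0 : sm ≠ 0 := natCast_sub_I_mul_sqrt_ne_zero x hd
  set g : A₁.prod A₂ ⟶ A₁.prod A₂ := x • 𝟙 (A₁.prod A₂) + (1 : ℕ) • ψ with hg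
  set T : complexBetti (A₁.prod A₂).X (2 * n) →ₗ[ℂ] complexBetti (A₁.prod A₂).X (2 * n) :=
    (singularCohomology.map ℂ ℂ (Motives.AlgPoints.mapContinuous (L := ℂ) g.hom.hom.hom) (2 * n)).hom
    with hT
  have hTapp : ∀ c : complexBetti (A₁.prod A₂).X (2 * n), T c =
      singularCohomology.map ℂ ℂ (Motives.AlgPoints.mapContinuous (L := ℂ) g.hom.hom.hom) (2 * n) c :=
    fun _ ↦ rfl
  -- the four pieces of `P = pr₁^* (u₁ + v₁) ∪ pr₂^* (u₂ + v₂)` and their eigenvalues under `T`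
  set P : complexBetti (A₁.prod A₂).X (2 * n) := cupProduct h (q₁ (u₁ + v₁)) (q₂ (u₂ + v₂)) with hPdef
  set P₁ : complexBetti (A₁.prod A₂).X (2 * n) := cupProduct h (q₁ u₁) (q₂ u₂) with hP₁
  set P₂ : complexBetti (A₁.prod A₂).X (2 * n) := cupProduct h (q₁ v₁) (q₂ v₂) with hP₂
  set P₃ : complexBetti (A₁.prod A₂).X (2 * n) := cupProduct h (q₁ u₁) (q₂ v₂) with hP₃
  set P₄ : complexBetti (A₁.prod A₂).X (2 * n) := cupProduct h (q₁ v₁) (q₂ u₂) with hP₄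
  have hP : P = P₁ + P₂ + P₃ + P₄ := by
    simp only [hPdef, hP₁, hP₂, hP₃, hP₄, hq₁, hq₂, map_add, LinearMap.add_apply]
    abel
  have hP₁W : P₁ ∈ weilClassesPlus (A₁.prod A₂) ψ n d :=
    cupProduct_map_map_mem_weilClassesPlus hp₁ hp₂ h hu₁ hu₂
  have hP₂W : P₂ ∈ weilClassesMinus (A₁.prod A₂) ψ n d :=
    cupProduct_map_map_mem_weilClassesMinus hp₁ hp₂ h hv₁ hv₂
  have hP₃W := cupProduct_map_map_mem_pullbackEigenclasses hp₁ hp₂ h hu₁ hv₂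
  have hP₄W := cupProduct_map_map_mem_pullbackEigenclasses hp₁ hp₂ h hv₁ hu₂
  have e₁ : T P₁ = sp ^ (2 * n) • P₁ := by
    have e := (mem_weilClassesPlus_iff.mp hP₁W) x 1
    simp only [Nat.cast_one, one_mul] at e
    rw [hTapp]
    exact e
  have e₂ : T P₂ = sm ^ (2 * n) • P₂ := by
    have e := (mem_weilClassesMinus_iff.mp hP₂W) x 1
    simp only [Nat.cast_one, one_mul] at e
    rw [hTapp]
    exact e
  have e₃ : T P₃ = (sp ^ (2 * n₁) * sm ^ (2 * n₂)) • P₃ := by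
    have e := (mem_pullbackEigenclasses_iff.mp hP₃W) x 1
    simp only [Nat.cast_one, one_mul] at e
    rw [hTapp]
    exact e
  have e₄ : T P₄ = (sm ^ (2 * n₁) * sp ^ (2 * n₂)) • P₄ := by
    have e := (mem_pullbackEigenclasses_iff.mp hP₄W) x 1
    simp only [Nat.cast_one, one_mul] at e
    rw [hTapp]
    exact e
  -- the eigenvalues and the projector `Q = q(T) P`, `q(X) = (X - β)(X - β')`
  set α : ℂ := sp ^ (2 * n) with hα
  set α' : ℂ := sm ^ (2 * n) with hα'
  set β : ℂ := sp ^ (2 * n₁) * sm ^ (2 * n₂) with hβ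
  set β' : ℂ := sm ^ (2 * n₁) * sp ^ (2 * n₂) with hβ'
  set Q : complexBetti (A₁.prod A₂).X (2 * n) := T (T P) - (β + β') • T P + (β * β') • P with hQdef
  have hQ : Q = ((α - β) * (α - β')) • P₁ + ((α' - β) * (α' - β')) • P₂ := by
    rw [hQdef]
    exact weilProjector_eq T hP e₁ e₂ e₃ e₄
  have hTQ : T Q = (α * ((α - β) * (α - β'))) • P₁ + (α' * ((α' - β) * (α' - β'))) • P₂ := by
    rw [hQdef]
    exact weilProjector_map_eq T hP e₁ e₂ e₃ e₄
  -- `Q` is a Weil class of `A₁ × A₂`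
  have hQW : Q ∈ weilClassesOf (A₁.prod A₂) ψ n d := by
    rw [hQ]
    exact Submodule.add_mem _
      (weilClassesPlus_le_weilClassesOf (A₁.prod A₂) ψ n d (Submodule.smul_mem _ _ hP₁W))
      (weilClassesMinus_le_weilClassesOf (A₁.prod A₂) ψ n d (Submodule.smul_mem _ _ hP₂W))
  -- `Q` is rational: `P` is, `T` preserves rationality, `β + β' ∈ ℤ`, `ββ' ∈ ℤ`
  have hPr : IsRationalClass P := (hr₁.map _).cup h (hr₂.map _)
  have hTPr : IsRationalClass (T P) := by rw [hTapp]; exact hPr.map _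
  have hTTPr : IsRationalClass (T (T P)) := by rw [hTapp]; exact hTPr.map _
  have hsum : sp + sm = ((2 * x : ℤ) : ℂ) := natCast_add_add_natCast_sub x _
  have hprod : sp * sm = ((x ^ 2 + d : ℤ) : ℂ) := natCast_add_mul_natCast_sub x d
  obtain ⟨zs, hzs⟩ : ∃ z : ℤ, (z : ℂ) = β + β' :=
    exists_intCast_eq_pow_mul_pow_add hsum hprod (2 * n₁) (2 * n₂)
  obtain ⟨zt, hzt⟩ : ∃ z : ℤ, (z : ℂ) = β * β' := by
    refine ⟨(x ^ 2 + d) ^ (2 * n₁ + 2 * n₂), ?_⟩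
    rw [Int.cast_pow, ← hprod, hβ, hβ']
    ring
  have hQr : IsRationalClass Q := by
    have e : Q = T (T P) + (((-zs : ℤ) : ℚ) : ℂ) • T P + (((zt : ℤ) : ℚ) : ℂ) • P := by
      rw [hQdef, Rat.cast_intCast, Rat.cast_intCast, Int.cast_neg, hzs, hzt, neg_smul,
        ← sub_eq_add_neg]
    rw [e]
    exact (hTTPr.add (hTPr.smul _)).add (hPr.smul _)
  -- `Q` is of Hodge type `(n, n)`: `P` is (Künneth for Hodge types), work in the witness model of `P`
  have hH : IsOfHodgeType (2 * n) (A₁.prod A₂).X (2 * n) n n P := by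
    have H := isOfHodgeType_cupProduct_fst_snd A₁ A₂ (2 * n₁) (2 * n₂) hA₁ hA₂ (2 * n₁) (2 * n₂)
      (2 * n) h n₁ n₁ n₂ n₂ (u₁ + v₁) (u₂ + v₂) hH₁ hH₂
    have hn : n₁ + n₂ = n := by omega
    rw [h, hn] at H
    exact H
  obtain ⟨M, hM⟩ := hH
  have hstab : ∀ c : complexBetti (A₁.prod A₂).X (2 * n), M.pullback (2 * n) c ∈ M.hodgePQ (2 * n) n n →
      M.pullback (2 * n) (T c) ∈ M.hodgePQ (2 * n) n n := fun c hc ↦ by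
    rw [hTapp]
    exact M.pullback_map_mem_hodgePQ_of_endomorphism hBX g.hom.hom.hom hc
  have hMP : P ∈ (M.hodgePQ (2 * n) n n).comap (M.pullback (2 * n)).hom := hM
  have hMQ : Q ∈ (M.hodgePQ (2 * n) n n).comap (M.pullback (2 * n)).hom := by
    rw [hQdef]
    refine Submodule.add_mem _ (Submodule.sub_mem _ ?_ (Submodule.smul_mem _ _ ?_))
      (Submodule.smul_mem _ _ hMP)
    · exact hstab _ (hstab _ hMP)
    · exact hstab _ hMP
  have hQH : IsOfHodgeType (2 * n) (A₁.prod A₂).X (2 * n) n n Q := ⟨M, hMQ⟩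
  -- the coefficients `q(α)`, `q(ᾱ)` are non-zero
  have hpow : ∀ s : ℂ, s ^ (2 * n) = s ^ (2 * n₁) * s ^ (2 * n₂) := fun s ↦ by rw [← pow_add, h]
  have ha : (α - β) * (α - β') ≠ 0 := by
    refine mul_ne_zero ?_ ?_
    · rw [hα, hβ, hpow, ← mul_sub]
      exact mul_ne_zero (pow_ne_zero _ hsp0) (sub_ne_zero.mpr hx₂)
    · rw [hα, hβ', hpow, ← sub_mul]
      exact mul_ne_zero (sub_ne_zero.mpr hx₁) (pow_ne_zero _ hsp0)
  have hb : (α' - β) * (α' - β') ≠ 0 := by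
    refine mul_ne_zero ?_ ?_
    · rw [hα', hβ, hpow, ← sub_mul]
      exact mul_ne_zero (sub_ne_zero.mpr hx₁.symm) (pow_ne_zero _ hsm0)
    · rw [hα', hβ', hpow, ← mul_sub]
      exact mul_ne_zero (pow_ne_zero _ hsm0) (sub_ne_zero.mpr hx₂.symm)
  -- `Q ≠ 0`: otherwise `P₊₊ = P₋₋ = 0`, but one of them is a non-zero exterior product
  refine ⟨Q, hQr, hQH, hQW, fun hQ0 ↦ ?_⟩
  have h₁ : ((α - β) * (α - β')) • P₁ + ((α' - β) * (α' - β')) • P₂ ∈ (⊥ : Submodule ℂ _) := by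
    rw [← hQ, hQ0]; exact Submodule.zero_mem _
  have h₂ : (α * ((α - β) * (α - β'))) • P₁ + (α' * ((α' - β) * (α' - β'))) • P₂ ∈
      (⊥ : Submodule ℂ _) := by
    rw [← hTQ, hQ0, map_zero]; exact Submodule.zero_mem _
  obtain ⟨hP₁0, hP₂0⟩ := mem_and_mem_of_smul_add_smul_mem ⊥ hx ha hb h₁ h₂
  rw [Submodule.mem_bot] at hP₁0 hP₂0
  rcases eq_or_ne u₁ 0 with hu₁0 | hu₁0
  · -- then `v₁ ≠ 0` and `P₋₋ ≠ 0`
    have hv₁0 : v₁ ≠ 0 := by rintro rfl; exact hc0 (by rw [hu₁0, add_zero])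
    exact sps_cupProduct_map_fst_map_snd_ne_zero_prod hA₁' hA₂' h hv₁0 hv₂0 hP₂0
  · exact sps_cupProduct_map_fst_map_snd_ne_zero_prod hA₁' hA₂' h hu₁0 hu₂0 hP₁0

end Summit.HodgeConjecture.HodgeConjecture.Theorems.HeckePrymWeilLine

end
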